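import Summits.QuantumFields.YangMills.Theses.LangevinControlUV
import Summits.QuantumFields.YangMills.Theorems.LatticeGapInUVUnits.Negative.WeakCouplingConcentration
import Summits.QuantumFields.YangMills.Theorems.LangevinControlUVOSLegsFromFemtoAndGapStubPinAux

/-!
# Crux `LatticeGapInUVUnits` (stmt-QuantumFields-9366), line `one-ruler`: ruler rigidity for continuous femto rulers

Support file for route `LangevinControlUV` of `YangMills` (line `one-ruler`, skeleton
`Cruxes/LatticeGapInUVUnits/Lines/one_ruler.lean` §2, planner gen 2; landed by lead c3).  Every statement is written
out in the route's own vocabulary (the `let`-body of the femto two-point package); no definition is introduced.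

* `ruler_dominates_of_upper` — **one-sided ruler domination from an upper bound**: if `a₁` is a CONTINUOUS unit map
  carrying only the axis UPPER femto bound `n⁸ Cov ≤ C Γ₁(n a₁ β)` with `Γ₁ ≥ 0` and `Γ₁(a₁ β) → 0`, and `a₂` is a
  CONTINUOUS unit map carrying a full package, then `a₂ ≤ K · a₁` eventually.  Proof: order bookkeeping plus two
  analytic inputs — weak-coupling concentration (the landed `Negative.tendsto_cov_plaquetteCost`, box `L = 8`) and
  continuity of `β ↦ E_{β,L}[F]` (tree `OSLegsFromFemtoAndGap.continuous_wilsonExpectation_beta`) — and the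
  intermediate value theorem twice: FLOOR — on the edge interval `s ∈ [ℓ₁/16, ℓ₁/8]` the package pins
  `c'Γ₂(s) ≥ η > 0` (every level is `a₂ β'` for `β'` in a compact set of couplings on which the box-`8` covariance,
  continuous and positive, is bounded below); CEILING — `Γ₁(x) < θ` for ALL small `x` (every small level is attained
  by `a₁`); COMPARISON at the femto edge of ruler 2.
* `ruler_dominates_of_packages`, `rulerRigidity_continuous` — **any two continuous unit maps carrying femto packages
  agree up to constants, eventually in `β`**: the socket of the repaired crux C′ (`Continuous a`, Disproof §9) is
  CANONICAL, and every certificate monotone along domination (the line's femto windows `FemtoWindowFrom`, the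
  sibling lines' block-sampler / slab certificates at cell `⌈K/a β⌉`) is independent of the continuous package ruler
  it is stated in.  No monotonicity of `Γ`, no physics.

References: the standing disproof `Cruxes/LatticeGapInUVUnits/Disproof.lean` §6 (concentration), §9 (C′), §11
(`ruler_lt_of_continuous`, landed as `Negative/ContinuousRulers.lean`: the one-threshold precursor).
-/

set_option autoImplicit false

noncomputable section

namespace Summit.QuantumFields.YangMills.Theorems.LatticeGapInUVUnits.OneRuler

open Filter Topology MeasureTheory
open Literature.MathematicalPhysics.QuantumFieldTheory Literature.MathematicalPhysics.QuantumLattice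
open Summit.QuantumFields.YangMills.Theorems.LatticeGapInUVUnits.Negative (tendsto_cov_plaquetteCost zero_lt_one_fin4)
open Summit.QuantumFields.YangMills.Theorems.OSLegsFromFemtoAndGap
  (continuous_wilsonExpectation_beta continuous_plaquetteCost)

/-- **One-sided ruler domination from an UPPER bound.**  Let `a₁` be a CONTINUOUS unit map with an axis upper femto
bound whose shape vanishes along it (`Γ₁ ≥ 0` on `(0, ℓ₀]`, `Γ₁(a₁ β) → 0`), and `a₂` a CONTINUOUS unit map carrying a
full femto two-point package.  Then `a₂ ≤ K · a₁` eventually (`K = max (ℓ₁/ℓ₀) (ℓ₁/(8α))`, `ℓ₁ = min ℓ₀' (8 a₂ β₀')`,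
`α` the ceiling level).  FLOOR by the intermediate value theorem for `a₂` on the compact set of couplings at which
`a₂` sits in the edge interval `[ℓ₁/16, ℓ₁/8]` and the minimum there of the continuous, positive box-`8` covariance;
CEILING by `Γ₁(a₁ β) → 0` and the intermediate value theorem for `a₁`; COMPARISON in the largest femto box of ruler 2
(`L = ⌊ℓ₁/a₂ β⌋`, `n = L/8`): either the box is not femto for ruler 1, or
`η ≤ c'Γ₂(n a₂ β) ≤ n⁸ Cov ≤ C Γ₁(n a₁ β)` forces `n a₁ β > α`. -/
theorem ruler_dominates_of_upper : ∀ (G : Type) [Group G] [TopologicalSpace G] [IsTopologicalGroup G] [CompactSpace G] [MeasurableSpace G] [BorelSpace G] (r : LatticeRep G) (a₁ a₂ Γ₁ Γ₂ : ℝ → ℝ) (β₀ ℓ₀ C β₀' ℓ₀' c' C' : ℝ),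
    (0 < ℓ₀ ∧ (∀ β, 0 < a₁ β) ∧ Filter.Tendsto a₁ Filter.atTop (nhds 0) ∧ (∀ s : ℝ, 0 < s → s ≤ ℓ₀ → 0 ≤ Γ₁ s) ∧
      Filter.Tendsto (fun β => Γ₁ (a₁ β)) Filter.atTop (nhds 0) ∧
      ∀ (L : ℕ) [NeZero L] (β : ℝ), β₀ ≤ β → (L : ℝ) * a₁ β ≤ ℓ₀ →
        let P : (Fin 4 → ZMod L) → Fin 4 → Fin 4 → GaugeConfig 4 L G → ℝ :=
          fun x i j U => (r.N : ℝ) - (r.ρ (plaquetteHolonomy U x i j)).trace.re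
        let E : (GaugeConfig 4 L G → ℝ) → ℝ := fun F => wilsonExpectation (d := 4) (L := L) r.ρ β F
        let cov : (GaugeConfig 4 L G → ℝ) → (GaugeConfig 4 L G → ℝ) → ℝ :=
          fun F F' => E (fun U => F U * F' U) - E F * E F'
        ∀ n : ℕ, 1 ≤ n → 8 * n ≤ L →
          (n : ℝ) ^ 8 * cov (P 0 0 1) (P (Pi.single (2 : Fin 4) ((n : ℕ) : ZMod L)) 0 1) ≤ C * Γ₁ ((n : ℝ) * a₁ β)) →
    Continuous a₁ →
    (0 < ℓ₀' ∧ 0 < c' ∧ (∀ β, 0 < a₂ β) ∧ Filter.Tendsto a₂ Filter.atTop (nhds 0) ∧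
      (∀ s : ℝ, 0 < s → s ≤ ℓ₀' → 0 < Γ₂ s ∧ Γ₂ s ≤ 1) ∧
      ∀ (L : ℕ) [NeZero L] (β : ℝ), β₀' ≤ β → (L : ℝ) * a₂ β ≤ ℓ₀' →
        let P : (Fin 4 → ZMod L) → Fin 4 → Fin 4 → GaugeConfig 4 L G → ℝ :=
          fun x i j U => (r.N : ℝ) - (r.ρ (plaquetteHolonomy U x i j)).trace.re
        let E : (GaugeConfig 4 L G → ℝ) → ℝ := fun F => wilsonExpectation (d := 4) (L := L) r.ρ β F
        let cov : (GaugeConfig 4 L G → ℝ) → (GaugeConfig 4 L G → ℝ) → ℝ :=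
          fun F F' => E (fun U => F U * F' U) - E F * E F'
        let dist : (Fin 4 → ZMod L) → (Fin 4 → ZMod L) → ℝ :=
          fun x y => Real.sqrt (∑ k : Fin 4, (((x k - y k).valMinAbs : ℤ) : ℝ) ^ 2)
        (∀ n : ℕ, 1 ≤ n → 8 * n ≤ L →
            c' * Γ₂ ((n : ℝ) * a₂ β) ≤ (n : ℝ) ^ 8 * cov (P 0 0 1) (P (Pi.single (2 : Fin 4) ((n : ℕ) : ZMod L)) 0 1) ∧
              (n : ℝ) ^ 8 * cov (P 0 0 1) (P (Pi.single (2 : Fin 4) ((n : ℕ) : ZMod L)) 0 1) ≤ C' * Γ₂ ((n : ℝ) * a₂ β)) ∧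
          (∀ (x y : Fin 4 → ZMod L) (i j i' j' : Fin 4), x ≠ y → i ≠ j → i' ≠ j' →
            |cov (P x i j) (P y i' j')| * dist x y ^ 8 ≤ C' * Γ₂ (dist x y * a₂ β))) →
    Continuous a₂ →
    ∃ K β₃ : ℝ, 0 < K ∧ ∀ β, β₃ ≤ β → a₂ β ≤ K * a₁ β := by
  intro G _ _ _ _ _ _ r a₁ a₂ Γ₁ Γ₂ β₀ ℓ₀ C β₀' ℓ₀' c' C' h₁ ha₁ h₂ ha₂
  obtain ⟨hℓ, hpos₁, hlim₁, hΓ₁, hv₁, hbox₁⟩ := h₁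
  have hℓ' : 0 < ℓ₀' := h₂.1
  have hc' : 0 < c' := h₂.2.1
  have hpos₂ : ∀ β, 0 < a₂ β := h₂.2.2.1
  have hlim₂ : Filter.Tendsto a₂ Filter.atTop (nhds 0) := h₂.2.2.2.1
  -- shrink the femto range of ruler 2 so that its first coupling sees the whole edge interval
  set ℓ₁ : ℝ := min ℓ₀' (8 * a₂ β₀') with hℓ₁def
  have hℓ₁pos : 0 < ℓ₁ := lt_min hℓ' (by linarith [hpos₂ β₀'])
  have hℓ₁le : ℓ₁ ≤ ℓ₀' := min_le_left _ _
  have hℓ₁le' : ℓ₁ ≤ 8 * a₂ β₀' := min_le_right _ _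
  obtain ⟨-, -, -, -, hΓ₂full, hbox₂full⟩ := h₂
  have hΓ₂ : ∀ s : ℝ, 0 < s → s ≤ ℓ₁ → 0 < Γ₂ s ∧ Γ₂ s ≤ 1 := fun s hs hsl => hΓ₂full s hs (hsl.trans hℓ₁le)
  -- the box-`8` axis covariance `Cov_{β,8}(P₀^{01}, P_{e₂}^{01})` as a (continuous) function of the coupling
  set cov8f : ℝ → ℝ := fun β' =>
    wilsonExpectation (d := 4) (L := 8) r.ρ β' (fun U => ((r.N : ℝ) - (r.ρ (plaquetteHolonomy U 0 0 1)).trace.re) *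
        ((r.N : ℝ) - (r.ρ (plaquetteHolonomy U (Pi.single (2 : Fin 4) (1 : ZMod 8)) 0 1)).trace.re)) -
      wilsonExpectation (d := 4) (L := 8) r.ρ β' (fun U => (r.N : ℝ) - (r.ρ (plaquetteHolonomy U 0 0 1)).trace.re) *
        wilsonExpectation (d := 4) (L := 8) r.ρ β'
          (fun U => (r.N : ℝ) - (r.ρ (plaquetteHolonomy U (Pi.single (2 : Fin 4) (1 : ZMod 8)) 0 1)).trace.re)
    with hcov8f
  have hcont8 : Continuous cov8f :=
    (continuous_wilsonExpectation_beta r ((continuous_plaquetteCost r 0 0 1).mul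
        (continuous_plaquetteCost r _ 0 1))).sub
      ((continuous_wilsonExpectation_beta r (continuous_plaquetteCost r 0 0 1)).mul
        (continuous_wilsonExpectation_beta r (continuous_plaquetteCost r _ 0 1)))
  -- FLOOR. The compact set of couplings at which ruler 2 sits in the edge interval
  set Kset : Set ℝ := Set.Ici β₀' ∩ a₂ ⁻¹' Set.Icc (ℓ₁ / 16) (ℓ₁ / 8) with hKdef
  obtain ⟨B₂, hB₂⟩ := Filter.eventually_atTop.1 (hlim₂ (Iio_mem_nhds (show (0 : ℝ) < ℓ₁ / 16 by positivity)))
  have hKsub : Kset ⊆ Set.Icc β₀' B₂ := by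
    intro β' hβ'
    refine ⟨hβ'.1, ?_⟩
    by_contra hlt
    push Not at hlt
    have h1 : a₂ β' < ℓ₁ / 16 := hB₂ β' hlt.le
    have h2 : ℓ₁ / 16 ≤ a₂ β' := hβ'.2.1
    linarith
  have hKclosed : IsClosed Kset := isClosed_Ici.inter (isClosed_Icc.preimage ha₂)
  have hKcpt : IsCompact Kset := isCompact_Icc.of_isClosed_subset hKclosed hKsub
  -- every level of the edge interval is attained inside `Kset` (intermediate value theorem)
  have hIVT : ∀ s : ℝ, ℓ₁ / 16 ≤ s → s ≤ ℓ₁ / 8 → ∃ β' ∈ Kset, a₂ β' = s := by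
    intro s hslo hshi
    have hspos : 0 < s := lt_of_lt_of_le (by positivity) hslo
    obtain ⟨B, hB⟩ := Filter.eventually_atTop.1 (hlim₂ (Iio_mem_nhds hspos))
    have htop : s ≤ a₂ β₀' := by linarith
    have hbot : a₂ (max β₀' B) < s := hB _ (le_max_right _ _)
    have hmem : s ∈ Set.Icc (a₂ (max β₀' B)) (a₂ β₀') := ⟨hbot.le, htop⟩
    obtain ⟨β', hβ'I, hβ's⟩ := intermediate_value_Icc' (le_max_left β₀' B) ha₂.continuousOn hmem
    exact ⟨β', ⟨hβ'I.1, by rw [Set.mem_preimage, hβ's]; exact ⟨hslo, hshi⟩⟩, hβ's⟩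
  have hKne : Kset.Nonempty := by
    obtain ⟨β', hβ', -⟩ := hIVT (ℓ₁ / 8) (by linarith) le_rfl
    exact ⟨β', hβ'⟩
  -- the box-`8` bounds on `Kset`
  have hcovK : ∀ β' ∈ Kset, c' * Γ₂ (a₂ β') ≤ cov8f β' ∧ cov8f β' ≤ C' * Γ₂ (a₂ β') := by
    intro β' hβ'
    have h8 : ((8 : ℕ) : ℝ) * a₂ β' ≤ ℓ₁ := by push_cast; linarith [hβ'.2.2]
    obtain ⟨hax, -⟩ := hbox₂full 8 β' hβ'.1 (h8.trans hℓ₁le)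
    have h1 := hax 1 le_rfl (by norm_num)
    simp only [Nat.cast_one, one_mul, one_pow] at h1
    exact h1
  obtain ⟨βm, hβmK, hβmin⟩ := hKcpt.exists_isMinOn hKne hcont8.continuousOn
  set m₀ : ℝ := cov8f βm with hm₀def
  have hΓ₂m : 0 < Γ₂ (a₂ βm) := (hΓ₂ (a₂ βm) (hpos₂ βm) (by linarith [hβmK.2.2])).1
  have hm₀pos : 0 < m₀ := lt_of_lt_of_le (mul_pos hc' hΓ₂m) (hcovK βm hβmK).1
  have hC'pos : 0 < C' := by
    have h := (hcovK βm hβmK).2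
    by_contra hle
    push Not at hle
    have : C' * Γ₂ (a₂ βm) ≤ 0 := mul_nonpos_of_nonpos_of_nonneg hle hΓ₂m.le
    linarith
  set η : ℝ := c' * m₀ / C' with hηdef
  have hη : 0 < η := by positivity
  have hΓ₂floor : ∀ s : ℝ, ℓ₁ / 16 ≤ s → s ≤ ℓ₁ / 8 → η ≤ c' * Γ₂ s := by
    intro s hlo hhi
    obtain ⟨β', hβ'K, hβ's⟩ := hIVT s hlo hhi
    have hup : cov8f β' ≤ C' * Γ₂ (a₂ β') := (hcovK β' hβ'K).2
    have hmin : m₀ ≤ cov8f β' := (isMinOn_iff.1 hβmin) β' hβ'K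
    rw [hβ's] at hup
    have hq : m₀ / C' ≤ Γ₂ s := by
      rw [div_le_iff₀ hC'pos]
      linarith
    calc η = c' * (m₀ / C') := by rw [hηdef]; ring
      _ ≤ c' * Γ₂ s := mul_le_mul_of_nonneg_left hq hc'.le
  -- CEILING. A fixed level `α` below which the shape of ruler 1 stays under `θ`
  set Cb : ℝ := max C 1 with hCbdef
  have hCb : 0 < Cb := lt_of_lt_of_le one_pos (le_max_right C 1)
  set θ : ℝ := η / Cb with hθdef
  have hθ : 0 < θ := div_pos hη hCb
  obtain ⟨β₄, hβ₄⟩ := Filter.eventually_atTop.1 ((tendsto_order.1 hv₁).2 θ hθ)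
  set α : ℝ := a₁ β₄ with hαdef
  have hα : 0 < α := hpos₁ β₄
  have hsmall : ∀ x : ℝ, 0 < x → x ≤ α → Γ₁ x < θ := by
    intro x hx hxα
    obtain ⟨B, hB⟩ := Filter.eventually_atTop.1 (hlim₁ (Iio_mem_nhds hx))
    have hbot : a₁ (max β₄ B) < x := hB _ (le_max_right _ _)
    have hmem : x ∈ Set.Icc (a₁ (max β₄ B)) (a₁ β₄) := ⟨hbot.le, hxα⟩
    obtain ⟨β', hβ'I, hβ'x⟩ := intermediate_value_Icc' (le_max_left β₄ B) ha₁.continuousOn hmem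
    rw [← hβ'x]
    exact hβ₄ β' hβ'I.1
  -- threshold `β₃`
  have hev₂ : ∀ᶠ β in atTop, a₂ β ≤ ℓ₁ / 18 := hlim₂ (Iic_mem_nhds (by positivity))
  obtain ⟨β₅, hβ₅⟩ := Filter.eventually_atTop.1
    (hev₂.and ((eventually_ge_atTop β₀).and (eventually_ge_atTop β₀')))
  refine ⟨max (ℓ₁ / ℓ₀) (ℓ₁ / (8 * α)), β₅, lt_max_of_lt_left (div_pos hℓ₁pos hℓ), fun β hβ => ?_⟩
  obtain ⟨ha₂, hb₀, hb₀'⟩ := hβ₅ β hβ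
  have ha₁pos : 0 < a₁ β := hpos₁ β
  have ha₂pos : 0 < a₂ β := hpos₂ β
  have hK₁ : ℓ₁ / ℓ₀ ≤ max (ℓ₁ / ℓ₀) (ℓ₁ / (8 * α)) := le_max_left _ _
  have hK₂ : ℓ₁ / (8 * α) ≤ max (ℓ₁ / ℓ₀) (ℓ₁ / (8 * α)) := le_max_right _ _
  -- COMPARISON. The largest femto box of ruler 2
  set L : ℕ := ⌊ℓ₁ / a₂ β⌋₊ with hLdef
  have hLle : (L : ℝ) ≤ ℓ₁ / a₂ β := Nat.floor_le (by positivity)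
  have hLge : ℓ₁ / a₂ β - 1 < (L : ℝ) := Nat.sub_one_lt_floor _
  have h18 : (18 : ℝ) ≤ ℓ₁ / a₂ β := by
    rw [le_div_iff₀ ha₂pos]
    have := (le_div_iff₀ (by norm_num : (0 : ℝ) < 18)).1 ha₂
    linarith
  have hL17R : (17 : ℝ) ≤ (L : ℝ) := by linarith
  have hL16 : 16 ≤ L := by exact_mod_cast (show ((16 : ℕ) : ℝ) ≤ (L : ℝ) by push_cast; linarith)
  haveI : NeZero L := ⟨by omega⟩
  set n : ℕ := L / 8 with hndef
  have hn1 : 1 ≤ n := by omega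
  have h8n : 8 * n ≤ L := by omega
  have hnlt : L < 8 * n + 8 := by omega
  have hnpos : (0 : ℝ) < n := by exact_mod_cast (show 0 < n by omega)
  have hnR : (8 : ℝ) * n ≤ L := by exact_mod_cast h8n
  have hnR' : (L : ℝ) < 8 * n + 8 := by exact_mod_cast hnlt
  -- femto for ruler 2, and the ruler-2 lower bound at separation `n`
  have hfem₂ : (L : ℝ) * a₂ β ≤ ℓ₁ := by rwa [← le_div_iff₀ ha₂pos]
  obtain ⟨hax₂, -⟩ := hbox₂full L β hb₀' (hfem₂.trans hℓ₁le)
  have hlow := (hax₂ n hn1 h8n).1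
  -- `n · a₂ β ∈ [ℓ₁/16, ℓ₁/8]`
  have hA : ℓ₁ - a₂ β ≤ (L : ℝ) * a₂ β := by
    have := mul_le_mul_of_nonneg_right hLge.le ha₂pos.le
    rwa [sub_mul, div_mul_cancel₀ ℓ₁ ha₂pos.ne', one_mul] at this
  have hB : (L : ℝ) * a₂ β < 8 * ((n : ℝ) * a₂ β) + 8 * a₂ β := by
    have := mul_lt_mul_of_pos_right hnR' ha₂pos
    have e : (8 * (n : ℝ) + 8) * a₂ β = 8 * ((n : ℝ) * a₂ β) + 8 * a₂ β := by ring
    linarith [e]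
  have hC₈ : 8 * ((n : ℝ) * a₂ β) ≤ (L : ℝ) * a₂ β := by
    have := mul_le_mul_of_nonneg_right hnR ha₂pos.le
    have e : (8 : ℝ) * n * a₂ β = 8 * ((n : ℝ) * a₂ β) := by ring
    linarith [e]
  have hs₂lo : ℓ₁ / 16 ≤ (n : ℝ) * a₂ β := by linarith
  have hs₂hi : (n : ℝ) * a₂ β ≤ ℓ₁ / 8 := by linarith
  have hηle : η ≤ c' * Γ₂ ((n : ℝ) * a₂ β) := hΓ₂floor _ hs₂lo hs₂hi
  -- case split: is the box femto for ruler 1?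
  by_cases hfem₁ : (L : ℝ) * a₁ β ≤ ℓ₀
  · -- Case B: both rulers see the box; compare the bounds at separation `n`
    have hup := hbox₁ L β hb₀ hfem₁ n hn1 h8n
    have key : c' * Γ₂ ((n : ℝ) * a₂ β) ≤ C * Γ₁ ((n : ℝ) * a₁ β) := hlow.trans hup
    have hxpos : 0 < (n : ℝ) * a₁ β := mul_pos hnpos ha₁pos
    have hx₈ : 8 * ((n : ℝ) * a₁ β) ≤ (L : ℝ) * a₁ β := by
      have := mul_le_mul_of_nonneg_right hnR ha₁pos.le
      have e : (8 : ℝ) * n * a₁ β = 8 * ((n : ℝ) * a₁ β) := by ring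
      linarith [e]
    have hxle : (n : ℝ) * a₁ β ≤ ℓ₀ := by linarith
    have hΓ₁x : 0 ≤ Γ₁ ((n : ℝ) * a₁ β) := hΓ₁ _ hxpos hxle
    have hCx : C * Γ₁ ((n : ℝ) * a₁ β) ≤ Cb * Γ₁ ((n : ℝ) * a₁ β) :=
      mul_le_mul_of_nonneg_right (le_max_left C 1) hΓ₁x
    have hθx : θ ≤ Γ₁ ((n : ℝ) * a₁ β) := by
      rw [hθdef, div_le_iff₀ hCb]
      nlinarith [hηle, key, hCx]
    -- the ceiling forces `n · a₁ β` above the fixed level `α`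
    have hna : α < (n : ℝ) * a₁ β := by
      by_contra hle
      push Not at hle
      have := hsmall _ hxpos hle
      linarith
    -- hence `a₂ β ≤ ℓ₁/(8α) · a₁ β`
    have hfin : a₂ β * (8 * α) ≤ ℓ₁ * a₁ β := by
      have h1 : a₂ β * (8 * α) ≤ a₂ β * (8 * ((n : ℝ) * a₁ β)) := by
        have : 8 * α ≤ 8 * ((n : ℝ) * a₁ β) := by linarith
        exact mul_le_mul_of_nonneg_left this ha₂pos.le
      have h2 : a₂ β * (8 * ((n : ℝ) * a₁ β)) = 8 * ((n : ℝ) * a₂ β) * a₁ β := by ring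
      have h3 : 8 * ((n : ℝ) * a₂ β) * a₁ β ≤ 8 * (ℓ₁ / 8) * a₁ β :=
        mul_le_mul_of_nonneg_right (by linarith) ha₁pos.le
      have h4 : 8 * (ℓ₁ / 8) * a₁ β = ℓ₁ * a₁ β := by ring
      linarith [h1, h2, h3, h4]
    have hdom : a₂ β ≤ ℓ₁ / (8 * α) * a₁ β := by
      rw [div_mul_eq_mul_div, le_div_iff₀ (by positivity)]
      linarith
    exact hdom.trans (mul_le_mul_of_nonneg_right hK₂ ha₁pos.le)
  · -- Case A: the box is NOT femto for ruler 1, i.e. `ℓ₀ < L · a₁ β`; then `a₂ β < (ℓ₁/ℓ₀) · a₁ β`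
    push Not at hfem₁
    have h1 : a₂ β * ℓ₀ < a₂ β * ((L : ℝ) * a₁ β) := mul_lt_mul_of_pos_left hfem₁ ha₂pos
    have h2 : a₂ β * ((L : ℝ) * a₁ β) = ((L : ℝ) * a₂ β) * a₁ β := by ring
    have h3 : ((L : ℝ) * a₂ β) * a₁ β ≤ ℓ₁ * a₁ β := mul_le_mul_of_nonneg_right hfem₂ ha₁pos.le
    have hdom : a₂ β ≤ ℓ₁ / ℓ₀ * a₁ β := by
      rw [div_mul_eq_mul_div, le_div_iff₀ hℓ]
      linarith
    exact hdom.trans (mul_le_mul_of_nonneg_right hK₁ ha₁pos.le)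

/-- **One-sided domination between CONTINUOUS package rulers** (the dominating ruler's package supplies its upper
femto bound with vanishing shape). -/
theorem ruler_dominates_of_packages : ∀ (G : Type) [Group G] [TopologicalSpace G] [IsTopologicalGroup G] [CompactSpace G] [MeasurableSpace G] [BorelSpace G] (r : LatticeRep G) (a₁ a₂ Γ₁ Γ₂ : ℝ → ℝ) (β₀ ℓ₀ c C β₀' ℓ₀' c' C' : ℝ),
    (0 < ℓ₀ ∧ 0 < c ∧ (∀ β, 0 < a₁ β) ∧ Filter.Tendsto a₁ Filter.atTop (nhds 0) ∧
      (∀ s : ℝ, 0 < s → s ≤ ℓ₀ → 0 < Γ₁ s ∧ Γ₁ s ≤ 1) ∧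
      ∀ (L : ℕ) [NeZero L] (β : ℝ), β₀ ≤ β → (L : ℝ) * a₁ β ≤ ℓ₀ →
        let P : (Fin 4 → ZMod L) → Fin 4 → Fin 4 → GaugeConfig 4 L G → ℝ :=
          fun x i j U => (r.N : ℝ) - (r.ρ (plaquetteHolonomy U x i j)).trace.re
        let E : (GaugeConfig 4 L G → ℝ) → ℝ := fun F => wilsonExpectation (d := 4) (L := L) r.ρ β F
        let cov : (GaugeConfig 4 L G → ℝ) → (GaugeConfig 4 L G → ℝ) → ℝ :=
          fun F F' => E (fun U => F U * F' U) - E F * E F'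
        let dist : (Fin 4 → ZMod L) → (Fin 4 → ZMod L) → ℝ :=
          fun x y => Real.sqrt (∑ k : Fin 4, (((x k - y k).valMinAbs : ℤ) : ℝ) ^ 2)
        (∀ n : ℕ, 1 ≤ n → 8 * n ≤ L →
            c * Γ₁ ((n : ℝ) * a₁ β) ≤ (n : ℝ) ^ 8 * cov (P 0 0 1) (P (Pi.single (2 : Fin 4) ((n : ℕ) : ZMod L)) 0 1) ∧
              (n : ℝ) ^ 8 * cov (P 0 0 1) (P (Pi.single (2 : Fin 4) ((n : ℕ) : ZMod L)) 0 1) ≤ C * Γ₁ ((n : ℝ) * a₁ β)) ∧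
          (∀ (x y : Fin 4 → ZMod L) (i j i' j' : Fin 4), x ≠ y → i ≠ j → i' ≠ j' →
            |cov (P x i j) (P y i' j')| * dist x y ^ 8 ≤ C * Γ₁ (dist x y * a₁ β))) →
    (0 < ℓ₀' ∧ 0 < c' ∧ (∀ β, 0 < a₂ β) ∧ Filter.Tendsto a₂ Filter.atTop (nhds 0) ∧
      (∀ s : ℝ, 0 < s → s ≤ ℓ₀' → 0 < Γ₂ s ∧ Γ₂ s ≤ 1) ∧
      ∀ (L : ℕ) [NeZero L] (β : ℝ), β₀' ≤ β → (L : ℝ) * a₂ β ≤ ℓ₀' →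
        let P : (Fin 4 → ZMod L) → Fin 4 → Fin 4 → GaugeConfig 4 L G → ℝ :=
          fun x i j U => (r.N : ℝ) - (r.ρ (plaquetteHolonomy U x i j)).trace.re
        let E : (GaugeConfig 4 L G → ℝ) → ℝ := fun F => wilsonExpectation (d := 4) (L := L) r.ρ β F
        let cov : (GaugeConfig 4 L G → ℝ) → (GaugeConfig 4 L G → ℝ) → ℝ :=
          fun F F' => E (fun U => F U * F' U) - E F * E F'
        let dist : (Fin 4 → ZMod L) → (Fin 4 → ZMod L) → ℝ :=
          fun x y => Real.sqrt (∑ k : Fin 4, (((x k - y k).valMinAbs : ℤ) : ℝ) ^ 2)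
        (∀ n : ℕ, 1 ≤ n → 8 * n ≤ L →
            c' * Γ₂ ((n : ℝ) * a₂ β) ≤ (n : ℝ) ^ 8 * cov (P 0 0 1) (P (Pi.single (2 : Fin 4) ((n : ℕ) : ZMod L)) 0 1) ∧
              (n : ℝ) ^ 8 * cov (P 0 0 1) (P (Pi.single (2 : Fin 4) ((n : ℕ) : ZMod L)) 0 1) ≤ C' * Γ₂ ((n : ℝ) * a₂ β)) ∧
          (∀ (x y : Fin 4 → ZMod L) (i j i' j' : Fin 4), x ≠ y → i ≠ j → i' ≠ j' →
            |cov (P x i j) (P y i' j')| * dist x y ^ 8 ≤ C' * Γ₂ (dist x y * a₂ β))) →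
    Continuous a₁ → Continuous a₂ →
    ∃ K β₃ : ℝ, 0 < K ∧ ∀ β, β₃ ≤ β → a₂ β ≤ K * a₁ β := by
  intro G _ _ _ _ _ _ r a₁ a₂ Γ₁ Γ₂ β₀ ℓ₀ c C β₀' ℓ₀' c' C' h₁ h₂ ha₁ ha₂
  refine ruler_dominates_of_upper G r a₁ a₂ Γ₁ Γ₂ β₀ ℓ₀ C β₀' ℓ₀' c' C' ?_ ha₁ h₂ ha₂
  -- the package of ruler 1 is an upper femto bound whose shape vanishes along `a₁` (box `L = 8`, `n = 1`, concentration)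
  obtain ⟨hℓ, hc, hpos, hlim, hΓ, hbox⟩ := h₁
  have hcov0 : Tendsto (fun β : ℝ => (wilsonExpectation (d := 4) (L := 8) r.ρ β (fun U => ((r.N : ℝ) - (r.ρ (plaquetteHolonomy U 0 0 1)).trace.re) *
            ((r.N : ℝ) - (r.ρ (plaquetteHolonomy U (Pi.single (2 : Fin 4) (1 : ZMod 8)) 0 1)).trace.re)) -
          wilsonExpectation (d := 4) (L := 8) r.ρ β (fun U => (r.N : ℝ) - (r.ρ (plaquetteHolonomy U 0 0 1)).trace.re) *
            wilsonExpectation (d := 4) (L := 8) r.ρ β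
              (fun U => (r.N : ℝ) - (r.ρ (plaquetteHolonomy U (Pi.single (2 : Fin 4) (1 : ZMod 8)) 0 1)).trace.re))) atTop (𝓝 0) :=
    tendsto_cov_plaquetteCost r 8 ((0 : Site 4 8), ⟨(0, 1), zero_lt_one_fin4⟩)
      ((Pi.single (2 : Fin 4) (1 : ZMod 8) : Site 4 8), ⟨(0, 1), zero_lt_one_fin4⟩)
  have hev : ∀ᶠ β in atTop, a₁ β < ℓ₀ / 8 := hlim (Iio_mem_nhds (by positivity))
  have hkey : ∀ᶠ β in atTop, 0 ≤ Γ₁ (a₁ β) ∧ Γ₁ (a₁ β) ≤ (wilsonExpectation (d := 4) (L := 8) r.ρ β (fun U => ((r.N : ℝ) - (r.ρ (plaquetteHolonomy U 0 0 1)).trace.re) *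
            ((r.N : ℝ) - (r.ρ (plaquetteHolonomy U (Pi.single (2 : Fin 4) (1 : ZMod 8)) 0 1)).trace.re)) -
          wilsonExpectation (d := 4) (L := 8) r.ρ β (fun U => (r.N : ℝ) - (r.ρ (plaquetteHolonomy U 0 0 1)).trace.re) *
            wilsonExpectation (d := 4) (L := 8) r.ρ β
              (fun U => (r.N : ℝ) - (r.ρ (plaquetteHolonomy U (Pi.single (2 : Fin 4) (1 : ZMod 8)) 0 1)).trace.re)) / c := by
    filter_upwards [hev, eventually_ge_atTop β₀] with β hβ hβ₀
    haveI : NeZero (8 : ℕ) := ⟨by norm_num⟩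
    obtain ⟨hax, -⟩ := hbox 8 β hβ₀ (by push_cast; linarith)
    have h1 := hax 1 le_rfl (by norm_num)
    simp only [Nat.cast_one, one_mul, one_pow] at h1
    have hΓ' := hΓ (a₁ β) (hpos β) (by linarith)
    refine ⟨hΓ'.1.le, ?_⟩
    rw [le_div_iff₀ hc]
    linarith [h1.1]
  have hv : Tendsto (fun β => Γ₁ (a₁ β)) atTop (𝓝 0) := by
    refine tendsto_of_tendsto_of_tendsto_of_le_of_le' tendsto_const_nhds ?_
      (hkey.mono fun β h => h.1) (hkey.mono fun β h => h.2)
    simpa using hcov0.div_const c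
  refine ⟨hℓ, hpos, hlim, fun s hs hsl => (hΓ s hs hsl).1.le, hv, fun L _ β hβ hL => ?_⟩
  obtain ⟨hax, -⟩ := hbox L β hβ hL
  exact fun n hn h8 => (hax n hn h8).2

/-- **Ruler rigidity (C′ form; registered stub).**  Any two CONTINUOUS unit maps carrying femto two-point packages
(for the same `G`, `r`; shapes, thresholds and constants arbitrary and unrelated) are equivalent up to a constant,
eventually in `β`: the femto socket of the repaired crux C′ (`Continuous a`) is canonical — whatever is certified in
the units of one continuous package ruler and is monotone along domination holds in the units of every other. -/
theorem rulerRigidity_continuous : ∀ (G : Type) [Group G] [TopologicalSpace G] [IsTopologicalGroup G] [CompactSpace G] [MeasurableSpace G] [BorelSpace G] (r : LatticeRep G) (a₁ a₂ Γ₁ Γ₂ : ℝ → ℝ) (β₀ ℓ₀ c C β₀' ℓ₀' c' C' : ℝ),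
    (0 < ℓ₀ ∧ 0 < c ∧ (∀ β, 0 < a₁ β) ∧ Filter.Tendsto a₁ Filter.atTop (nhds 0) ∧
      (∀ s : ℝ, 0 < s → s ≤ ℓ₀ → 0 < Γ₁ s ∧ Γ₁ s ≤ 1) ∧
      ∀ (L : ℕ) [NeZero L] (β : ℝ), β₀ ≤ β → (L : ℝ) * a₁ β ≤ ℓ₀ →
        let P : (Fin 4 → ZMod L) → Fin 4 → Fin 4 → GaugeConfig 4 L G → ℝ :=
          fun x i j U => (r.N : ℝ) - (r.ρ (plaquetteHolonomy U x i j)).trace.re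
        let E : (GaugeConfig 4 L G → ℝ) → ℝ := fun F => wilsonExpectation (d := 4) (L := L) r.ρ β F
        let cov : (GaugeConfig 4 L G → ℝ) → (GaugeConfig 4 L G → ℝ) → ℝ :=
          fun F F' => E (fun U => F U * F' U) - E F * E F'
        let dist : (Fin 4 → ZMod L) → (Fin 4 → ZMod L) → ℝ :=
          fun x y => Real.sqrt (∑ k : Fin 4, (((x k - y k).valMinAbs : ℤ) : ℝ) ^ 2)
        (∀ n : ℕ, 1 ≤ n → 8 * n ≤ L →
            c * Γ₁ ((n : ℝ) * a₁ β) ≤ (n : ℝ) ^ 8 * cov (P 0 0 1) (P (Pi.single (2 : Fin 4) ((n : ℕ) : ZMod L)) 0 1) ∧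
              (n : ℝ) ^ 8 * cov (P 0 0 1) (P (Pi.single (2 : Fin 4) ((n : ℕ) : ZMod L)) 0 1) ≤ C * Γ₁ ((n : ℝ) * a₁ β)) ∧
          (∀ (x y : Fin 4 → ZMod L) (i j i' j' : Fin 4), x ≠ y → i ≠ j → i' ≠ j' →
            |cov (P x i j) (P y i' j')| * dist x y ^ 8 ≤ C * Γ₁ (dist x y * a₁ β))) →
    (0 < ℓ₀' ∧ 0 < c' ∧ (∀ β, 0 < a₂ β) ∧ Filter.Tendsto a₂ Filter.atTop (nhds 0) ∧
      (∀ s : ℝ, 0 < s → s ≤ ℓ₀' → 0 < Γ₂ s ∧ Γ₂ s ≤ 1) ∧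
      ∀ (L : ℕ) [NeZero L] (β : ℝ), β₀' ≤ β → (L : ℝ) * a₂ β ≤ ℓ₀' →
        let P : (Fin 4 → ZMod L) → Fin 4 → Fin 4 → GaugeConfig 4 L G → ℝ :=
          fun x i j U => (r.N : ℝ) - (r.ρ (plaquetteHolonomy U x i j)).trace.re
        let E : (GaugeConfig 4 L G → ℝ) → ℝ := fun F => wilsonExpectation (d := 4) (L := L) r.ρ β F
        let cov : (GaugeConfig 4 L G → ℝ) → (GaugeConfig 4 L G → ℝ) → ℝ :=
          fun F F' => E (fun U => F U * F' U) - E F * E F'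
        let dist : (Fin 4 → ZMod L) → (Fin 4 → ZMod L) → ℝ :=
          fun x y => Real.sqrt (∑ k : Fin 4, (((x k - y k).valMinAbs : ℤ) : ℝ) ^ 2)
        (∀ n : ℕ, 1 ≤ n → 8 * n ≤ L →
            c' * Γ₂ ((n : ℝ) * a₂ β) ≤ (n : ℝ) ^ 8 * cov (P 0 0 1) (P (Pi.single (2 : Fin 4) ((n : ℕ) : ZMod L)) 0 1) ∧
              (n : ℝ) ^ 8 * cov (P 0 0 1) (P (Pi.single (2 : Fin 4) ((n : ℕ) : ZMod L)) 0 1) ≤ C' * Γ₂ ((n : ℝ) * a₂ β)) ∧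
          (∀ (x y : Fin 4 → ZMod L) (i j i' j' : Fin 4), x ≠ y → i ≠ j → i' ≠ j' →
            |cov (P x i j) (P y i' j')| * dist x y ^ 8 ≤ C' * Γ₂ (dist x y * a₂ β))) →
    Continuous a₁ → Continuous a₂ →
    ∃ K β₃ : ℝ, 0 < K ∧ ∀ β, β₃ ≤ β → a₂ β ≤ K * a₁ β ∧ a₁ β ≤ K * a₂ β := by
  intro G _ _ _ _ _ _ r a₁ a₂ Γ₁ Γ₂ β₀ ℓ₀ c C β₀' ℓ₀' c' C' h₁ h₂ ha₁ ha₂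
  obtain ⟨K₁, β₁, hK₁, hd₁⟩ :=
    ruler_dominates_of_packages G r a₁ a₂ Γ₁ Γ₂ β₀ ℓ₀ c C β₀' ℓ₀' c' C' h₁ h₂ ha₁ ha₂
  obtain ⟨K₂, β₂, hK₂, hd₂⟩ :=
    ruler_dominates_of_packages G r a₂ a₁ Γ₂ Γ₁ β₀' ℓ₀' c' C' β₀ ℓ₀ c C h₂ h₁ ha₂ ha₁
  refine ⟨max K₁ K₂, max β₁ β₂, lt_max_of_lt_left hK₁, fun β hβ => ⟨?_, ?_⟩⟩
  · exact (hd₁ β (le_of_max_le_left hβ)).trans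
      (mul_le_mul_of_nonneg_right (le_max_left _ _) (h₁.2.2.1 β).le)
  · exact (hd₂ β (le_of_max_le_right hβ)).trans
      (mul_le_mul_of_nonneg_right (le_max_right _ _) (h₂.2.2.1 β).le)

end Summit.QuantumFields.YangMills.Theorems.LatticeGapInUVUnits.OneRuler

end
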